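import Literature.AlgebraicGeometry.Resolution.RegularSystemOfParameters
import HarnessLib

/-!
# Powers of primes generated by part of a regular system of parameters are primary

Topic: `Literature/AlgebraicGeometry/Resolution`. A commutative-algebra brick for BGMW 2011,
Lemma 3.2.1 (1) ("`𝓘 ⊂ 𝓘_C^μ` for a smooth centre `C ⊆ supp(𝓘, μ)`", `MarkedIdeals.lean`): in a
regular local ring `(A, 𝔪)` with regular system of parameters `x_1, …, x_d`, for the prime
`P = (x_i : i ∈ S)` generated by part of it, **the ordinary powers `Pⁿ` are `P`-primary**
(`(Pⁿ : a) = Pⁿ` for `a ∉ P`), i.e. the symbolic powers `P⁽ⁿ⁾ = Pⁿ A_P ∩ A` equal `Pⁿ` — so that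
"`ord_η(f) ≥ n` at the generic point `η` of `V(P)`" means `f ∈ Pⁿ`. PROVED from Matsumura's
Thm. 16.2 (Rees: an `A`-sequence is quasi-regular, and then `(I^ν : a) = I^ν` whenever
`(I : a) = I`; `QuasiRegularSequences.lean`) and Thm. 17.8 / 14.2–14.3 (part of a regular system
of parameters is an `A`-sequence generating a prime ideal; `RegularSystemOfParameters.lean`):

* `regularSeq_rsop_comp` — a sub-family `x ∘ e` (`e : Fin c → Fin d` injective) of a regular
  system of parameters is an `A`-sequence in Matsumura's elementwise sense;
* `isQuasiRegular_rsop_comp` — hence quasi-regular (Thm. 16.2 (i));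
* `mem_pow_span_image_rsop_of_mul_mem` — **`a ∉ P`, `a y ∈ Pⁿ` ⇒ `y ∈ Pⁿ`** for
  `P = (x_i : i ∈ S)` (Thm. 16.2 (ii)).

## Sources

* H. Matsumura, *Commutative Ring Theory*, CUP 1986, Thm. 16.2 (i), (ii) (p. 125), Thm. 17.8
  (p. 137), Thm. 14.2, 14.3 (pp. 105–107). [Matsumura1987]
* E. Bierstone, D. Grigoriev, P. Milman, J. Włodarczyk, arXiv:1206.3090, Lemma 3.2.1 (1) — the
  application. [BierstoneGrigorievMilmanWlodarczyk2011]
-/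

namespace Literature.AlgebraicGeometry.Resolution

universe u

open IsLocalRing

variable {R : Type u} [CommRing R] [IsRegularLocalRing R] {d : ℕ}
  (hd : (maximalIdeal R).spanFinrank = d) (x : Fin d → R)
  (hx : Ideal.span (Set.range x) = maximalIdeal R)

include hd hx in
/-- **A sub-family of a regular system of parameters is an `A`-sequence** (Matsumura Thm. 17.8
for the regular s.o.p. reordered so that the sub-family comes first; here directly: the ideals
`(x_{e j} : j < i)` are prime (Thm. 14.2–14.3) and do not contain `x_{e i}` (minimality)):
`x_{e i} y ∈ (x_{e j} : j < i)` implies `y ∈ (x_{e j} : j < i)`. [cite: Matsumura1987, Thm. 17.8] -/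
theorem regularSeq_rsop_comp {c : ℕ} (e : Fin c → Fin d) (he : Function.Injective e)
    (i : Fin c) (y : R) (hy : (x ∘ e) i * y ∈ Ideal.span ((x ∘ e) '' Set.Iio i)) :
    y ∈ Ideal.span ((x ∘ e) '' Set.Iio i) := by
  classical
  -- `(x ∘ e)(Iio i) = x(T)` for the finset `T = e(Iio i) ∌ e i`
  set T : Finset (Fin d) := (Finset.Iio i).map ⟨e, he⟩ with hT
  have hTe : (x ∘ e) '' Set.Iio i = x '' (T : Set (Fin d)) := by
    rw [Set.image_comp, hT, Finset.coe_map, Finset.coe_Iio]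
    rfl
  have hiT : e i ∉ (T : Set (Fin d)) := by
    rw [hT, Finset.coe_map, Finset.coe_Iio]
    rintro ⟨j, hj, hji⟩
    exact (lt_irrefl i) ((he hji) ▸ hj)
  rw [hTe] at hy ⊢
  have hP := isPrime_span_image hd x hx T
  refine (hP.mem_or_mem hy).resolve_left ?_
  exact not_mem_span_image_of_not_mem hd x hx hiT

include hd hx in
/-- Hence a sub-family of a regular system of parameters is quasi-regular (Matsumura Thm. 16.2
(i), Rees). [cite: Matsumura1987, Thm. 16.2 (i)] -/
theorem isQuasiRegular_rsop_comp {c : ℕ} (e : Fin c → Fin d) (he : Function.Injective e) :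
    IsQuasiRegular (x ∘ e) :=
  isQuasiRegular_of_regularSeq c (x ∘ e) (regularSeq_rsop_comp hd x hx e he)

include hd hx in
/-- **The powers of `P = (x_i : i ∈ S)` are `P`-primary** (symbolic powers = ordinary powers)
for `P` generated by part of a regular system of parameters of a regular local ring: if `a ∉ P`
and `a y ∈ Pⁿ` then `y ∈ Pⁿ` (Matsumura Thm. 16.2 (ii) for the quasi-regular sequence
`(x_i)_{i ∈ S}`, `(P : a) = P` as `P` is prime). [cite: Matsumura1987, Thm. 16.2 (ii)] -/
theorem mem_pow_span_image_rsop_of_mul_mem (S : Finset (Fin d)) {a : R}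
    (ha : a ∉ Ideal.span (x '' (S : Set (Fin d)))) (n : ℕ) {y : R}
    (h : a * y ∈ Ideal.span (x '' (S : Set (Fin d))) ^ n) :
    y ∈ Ideal.span (x '' (S : Set (Fin d))) ^ n := by
  -- enumerate `S` increasingly: `e : Fin #S ↪o Fin d`, `range e = S`
  let e := S.orderEmbOfFin rfl
  have he : Function.Injective e := e.injective
  have hrange : Set.range (x ∘ e) = x '' (S : Set (Fin d)) := by
    rw [Set.range_comp, Finset.range_orderEmbOfFin]
  have hq := isQuasiRegular_rsop_comp hd x hx e he
  have hP : (Ideal.span (Set.range (x ∘ e))).IsPrime := by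
    rw [hrange]; exact isPrime_span_image hd x hx S
  rw [← hrange] at ha h ⊢
  exact hq.mem_pow_of_mul_mem_pow (fun z hz => ((hP.mem_or_mem hz).resolve_left ha)) n h

end Literature.AlgebraicGeometry.Resolution
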